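import Literature.NumberTheory.LFunctions.ZetaPartialSumAtZeros
import Literature.NumberTheory.LFunctions.ZeroSumSobolev
import Literature.NumberTheory.LFunctions.DirichletPolynomialStripMeanValue
import HarnessLib

/-!
# `∑_{T < γ ≤ 2T} m(ρ) |ζ_M(ρ) ζ_M(1-ρ)|` for `T ≥ M`: Lindelöf on average at the zeros

Topic `Literature/NumberTheory/LFunctions`. For the partial sums `ζ_M(s) = ∑_{k≤M} k^{-s}` and
a dyadic block of non-trivial zeros `ρ = β + iγ` of `ζ` at heights `T < γ ≤ 2T` ABOVE the length
(`T ≥ M`), counted with multiplicity and with no hypothesis on `β`,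
`∑ m(ρ) |ζ_M(ρ)| |ζ_M(1-ρ)| ≤ C (log(2T+2))³ T (T/M)^{3/2}`:
square-root cancellation on average in BOTH factors simultaneously (the trivial bound for the
product is `≍ M log M` per zero, the number of zeros is `≍ T log T`).  No zero-density estimate is
used: by the uniform truncation (4.11.1) and `ζ(ρ) = ζ(1-ρ) = 0`, `ζ_M(ρ) = -∑_{M<k≤2T} k^{-ρ}`
`+ O(T^{-β})` and `ζ_M(1-ρ) = -∑_{M<l≤2T} l^{ρ-1} + O(T^{β-1})`
(`Literature/NumberTheory/LFunctions/ZetaPartialSumAtZeros.lean`), and the resulting two-sided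
products `(∑ k^{-s})(∑ l^{s-1})` have first moments bounded UNIFORMLY on every line of the
critical strip (`Literature/NumberTheory/LFunctions/DirichletPolynomialStripMeanValue.lean`);
the passage from lines to zeros is Sobolev's inequality on unit squares and the local zero count
`N(a+1) - N(a) ≪ log a` (`Literature/NumberTheory/LFunctions/ZeroSumSobolev.lean`).

* `Literature.NumberTheory.LFunctions.hasDerivAt_twoSided` — `s`-derivative of a two-sided product;
* `Literature.NumberTheory.LFunctions.sum_zerosBetween_norm_twoSided_le` — the zero sum of one
  two-sided product `(∑_{A} k^{-s})(∑_{B} l^{s-1})`, `A, B ⊆ (M, X]`;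
* `Literature.NumberTheory.LFunctions.exists_sum_zerosBetween_norm_zetaPartialSum_mul_le` — the
  block estimate above.

## References

* E. C. Titchmarsh, *The Theory of the Riemann Zeta-Function*, 2nd ed. (1986), Theorem 4.11,
  eq. (4.11.1); Thm. 9.2.
* A. Ivić, *The Riemann Zeta-Function* (1985), Theorem 5.2, (5.15)–(5.16).
-/

noncomputable section

open Complex MeasureTheory Set Filter Finset intervalIntegral
open scoped Real Topology

namespace Literature.NumberTheory.LFunctions

/-! ## Derivatives of two-sided products -/

/-- `d/ds ∑_{A} u_k k^{-s} = ∑_{A} (-u_k log k) k^{-s}` (`0 ∉ A`). [folklore] -/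
theorem hasDerivAt_sum_weighted_cpow_neg {A : Finset ℕ} (hA : ∀ k ∈ A, k ≠ 0) (u : ℕ → ℝ)
    (s : ℂ) :
    HasDerivAt (fun s : ℂ ↦ ∑ k ∈ A, (u k : ℂ) * (k : ℂ) ^ (-s))
      (∑ k ∈ A, ((-(u k * Real.log k) : ℝ) : ℂ) * (k : ℂ) ^ (-s)) s := by
  refine HasDerivAt.fun_sum fun k hk ↦ ?_
  have hk0 : (k : ℂ) ≠ 0 := Nat.cast_ne_zero.2 (hA k hk)
  have h1 : HasDerivAt (fun y : ℂ ↦ (k : ℂ) ^ y) ((k : ℂ) ^ (-s) * Complex.log k) (-s) :=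
    (hasStrictDerivAt_const_cpow (Or.inl hk0)).hasDerivAt
  have h2 : HasDerivAt (fun y : ℂ ↦ (k : ℂ) ^ (-y)) ((k : ℂ) ^ (-s) * Complex.log k * (-1)) s :=
    h1.comp s (hasDerivAt_neg s)
  refine (h2.const_mul (u k : ℂ)).congr_deriv ?_
  rw [← Complex.natCast_log]
  push_cast
  ring

/-- `d/ds ∑_{B} v_l l^{s-1} = ∑_{B} (v_l log l) l^{s-1}` (`0 ∉ B`). [folklore] -/
theorem hasDerivAt_sum_weighted_cpow_sub_one {B : Finset ℕ} (hB : ∀ l ∈ B, l ≠ 0) (v : ℕ → ℝ)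
    (s : ℂ) :
    HasDerivAt (fun s : ℂ ↦ ∑ l ∈ B, (v l : ℂ) * (l : ℂ) ^ (s - 1))
      (∑ l ∈ B, (((v l * Real.log l) : ℝ) : ℂ) * (l : ℂ) ^ (s - 1)) s := by
  refine HasDerivAt.fun_sum fun l hl ↦ ?_
  have hl0 : (l : ℂ) ≠ 0 := Nat.cast_ne_zero.2 (hB l hl)
  have h1 : HasDerivAt (fun y : ℂ ↦ (l : ℂ) ^ y) ((l : ℂ) ^ (s - 1) * Complex.log l) (s - 1) :=
    (hasStrictDerivAt_const_cpow (Or.inl hl0)).hasDerivAt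
  have h2 : HasDerivAt (fun y : ℂ ↦ (l : ℂ) ^ (y - 1)) ((l : ℂ) ^ (s - 1) * Complex.log l * 1) s :=
    h1.comp s ((hasDerivAt_id s).sub_const 1)
  refine (h2.const_mul (v l : ℂ)).congr_deriv ?_
  rw [← Complex.natCast_log]
  push_cast
  ring

/-- **Derivative of a two-sided product** `(∑_A u_k k^{-s})(∑_B v_l l^{s-1})`. [folklore] -/
theorem hasDerivAt_twoSided {A B : Finset ℕ} (hA : ∀ k ∈ A, k ≠ 0) (hB : ∀ l ∈ B, l ≠ 0)
    (u v : ℕ → ℝ) (s : ℂ) :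
    HasDerivAt (fun s : ℂ ↦ (∑ k ∈ A, (u k : ℂ) * (k : ℂ) ^ (-s))
        * (∑ l ∈ B, (v l : ℂ) * (l : ℂ) ^ (s - 1)))
      ((∑ k ∈ A, ((-(u k * Real.log k) : ℝ) : ℂ) * (k : ℂ) ^ (-s))
          * (∑ l ∈ B, (v l : ℂ) * (l : ℂ) ^ (s - 1))
        + (∑ k ∈ A, (u k : ℂ) * (k : ℂ) ^ (-s))
          * (∑ l ∈ B, (((v l * Real.log l) : ℝ) : ℂ) * (l : ℂ) ^ (s - 1))) s :=
  (hasDerivAt_sum_weighted_cpow_neg hA u s).mul (hasDerivAt_sum_weighted_cpow_sub_one hB v s)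

/-- Strip integrals are subadditive: `I(G₁ + G₂) ≤ I(G₁) + I(G₂)` for continuous `G₁, G₂`,
`I(G) = ∫_0^1 ∫_a^b ‖G(σ+it)‖ dt dσ` (`a ≤ b`). [folklore] -/
theorem strip_integral_norm_add_le {G₁ G₂ : ℂ → ℂ} (h₁ : Continuous G₁) (h₂ : Continuous G₂)
    {a b : ℝ} (hab : a ≤ b) :
    ∫ σ in (0 : ℝ)..1, ∫ t in a..b, ‖G₁ (σ + t * I) + G₂ (σ + t * I)‖
      ≤ (∫ σ in (0 : ℝ)..1, ∫ t in a..b, ‖G₁ (σ + t * I)‖)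
        + ∫ σ in (0 : ℝ)..1, ∫ t in a..b, ‖G₂ (σ + t * I)‖ := by
  have hc : ∀ {G : ℂ → ℂ}, Continuous G → ∀ a b : ℝ,
      Continuous fun σ : ℝ ↦ ∫ t in a..b, ‖G (σ + t * I)‖ := fun hG a b ↦
    intervalIntegral.continuous_parametric_intervalIntegral_of_continuous' (by fun_prop) _ _
  have hinner : ∀ σ : ℝ, ∫ t in a..b, ‖G₁ (σ + t * I) + G₂ (σ + t * I)‖
      ≤ (∫ t in a..b, ‖G₁ (σ + t * I)‖) + ∫ t in a..b, ‖G₂ (σ + t * I)‖ := by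
    intro σ
    have hline : Continuous fun t : ℝ ↦ (σ : ℂ) + t * I := by fun_prop
    have c1 : Continuous fun t : ℝ ↦ ‖G₁ (σ + t * I)‖ := (h₁.comp hline).norm
    have c2 : Continuous fun t : ℝ ↦ ‖G₂ (σ + t * I)‖ := (h₂.comp hline).norm
    have c12 : Continuous fun t : ℝ ↦ ‖G₁ (σ + t * I) + G₂ (σ + t * I)‖ :=
      ((h₁.comp hline).add (h₂.comp hline)).norm
    rw [← intervalIntegral.integral_add (c1.intervalIntegrable _ _) (c2.intervalIntegrable _ _)]
    exact intervalIntegral.integral_mono_on hab (c12.intervalIntegrable _ _)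
      ((c1.add c2).intervalIntegrable _ _) fun t _ ↦ norm_add_le _ _
  have h12 : Continuous fun s : ℂ ↦ G₁ s + G₂ s := h₁.add h₂
  rw [← intervalIntegral.integral_add ((hc h₁ a b).intervalIntegrable _ _)
    ((hc h₂ a b).intervalIntegrable _ _)]
  exact intervalIntegral.integral_mono_on zero_le_one ((hc h12 a b).intervalIntegrable _ _)
    (((hc h₁ a b).add (hc h₂ a b)).intervalIntegrable _ _) fun σ _ ↦ hinner σ

/-! ## The zero sum of one two-sided product -/

/-- **Zero sum of a two-sided product**: for `A, B ⊆ (M, X]` (`1 ≤ M ≤ X`), naturals `T, K`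
with `T + K ≤ T'`, and the local count `N(a+1) - N(a) ≤ A₀ log(a+2)` (`a ≥ 0`, `A₀ ≥ 0`):
`∑_{T < γ ≤ T+K} m(ρ) ‖(∑_A k^{-ρ})(∑_B l^{ρ-1})‖`
`≤ A₀ log(T+K+2) (1 + 2 log X)² (5T' + 18X) (X/M)^{3/2}`.
[cite: Ivic1985, (5.15)–(5.16) and Theorem 5.2] -/
theorem sum_zerosBetween_norm_twoSided_le {M X : ℕ} (hM : 1 ≤ M) (hMX : M ≤ X)
    {A B : Finset ℕ} (hA : A ⊆ Finset.Ioc M X) (hB : B ⊆ Finset.Ioc M X)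
    {T K : ℕ} {T' : ℝ} (hT' : 0 < T') (hTK : ((T + K : ℕ) : ℝ) ≤ T')
    {A₀ : ℝ} (hA00 : 0 ≤ A₀)
    (hA₀ : ∀ a : ℝ, 0 ≤ a → (zetaZeroCount (a + 1) : ℝ) - zetaZeroCount a ≤ A₀ * Real.log (a + 2)) :
    ∑ ρ ∈ SchoenfeldBound.zerosBetween (T : ℝ) ((T + K : ℕ) : ℝ),
        (riemannZetaZeroOrder ρ : ℝ) *
          ‖(∑ k ∈ A, (k : ℂ) ^ (-ρ)) * (∑ l ∈ B, (l : ℂ) ^ (ρ - 1))‖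
      ≤ A₀ * Real.log ((T + K : ℕ) + 2) * ((1 + 2 * Real.log X) ^ 2
          * ((5 * T' + 18 * X) * ((X : ℝ) / M) ^ (3 / 2 : ℝ))) := by
  have hX1 : 1 ≤ X := hM.trans hMX
  have hX0 : (0 : ℝ) < X := by exact_mod_cast hX1
  have hA0 : ∀ k ∈ A, k ≠ 0 := fun k hk ↦ by have := (Finset.mem_Ioc.1 (hA hk)).1; omega
  have hB0 : ∀ l ∈ B, l ≠ 0 := fun l hl ↦ by have := (Finset.mem_Ioc.1 (hB hl)).1; omega
  set L : ℝ := Real.log X with hL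
  have hL0 : 0 ≤ L := Real.log_nonneg (by exact_mod_cast hX1)
  -- the two-sided products
  set tw : (ℕ → ℝ) → (ℕ → ℝ) → ℂ → ℂ := fun u v s ↦
    (∑ k ∈ A, (u k : ℂ) * (k : ℂ) ^ (-s)) * (∑ l ∈ B, (v l : ℂ) * (l : ℂ) ^ (s - 1)) with htw
  have hderiv : ∀ u v : ℕ → ℝ, ∀ s, HasDerivAt (tw u v)
      (tw (fun k ↦ -(u k * Real.log k)) v s + tw u (fun l ↦ v l * Real.log l) s) s := by
    intro u v s
    have h := hasDerivAt_twoSided hA0 hB0 u v s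
    simp only [htw]
    convert h using 2
  have hcont : ∀ u v : ℕ → ℝ, Continuous (tw u v) := fun u v ↦
    continuous_iff_continuousAt.2 fun s ↦ (hderiv u v s).continuousAt
  -- the weights `1`, `∓log`, `log²` and their bounds
  have hlogk : ∀ k ∈ Finset.Ioc M X, 0 ≤ Real.log k ∧ Real.log k ≤ L := by
    intro k hk
    obtain ⟨hk1, hk2⟩ := Finset.mem_Ioc.1 hk
    exact ⟨Real.log_nonneg (by exact_mod_cast (show 1 ≤ k by omega)),
      Real.log_le_log (by exact_mod_cast (show 0 < k by omega)) (by exact_mod_cast hk2)⟩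
  set u0 : ℕ → ℝ := fun _ ↦ 1 with hu0
  set u1 : ℕ → ℝ := fun k ↦ -(u0 k * Real.log k) with hu1
  set v1 : ℕ → ℝ := fun l ↦ u0 l * Real.log l with hv1
  set u2 : ℕ → ℝ := fun k ↦ -(u1 k * Real.log k) with hu2
  set v2 : ℕ → ℝ := fun l ↦ v1 l * Real.log l with hv2
  have bu0 : ∀ k ∈ A, |u0 k| ≤ 1 := fun k _ ↦ by simp [hu0]
  have bv0 : ∀ l ∈ B, |u0 l| ≤ 1 := fun l _ ↦ by simp [hu0]
  have bu1 : ∀ k ∈ A, |u1 k| ≤ L := fun k hk ↦ by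
    obtain ⟨h1, h2⟩ := hlogk k (hA hk)
    simpa [hu1, hu0, abs_of_nonneg h1] using h2
  have bv1 : ∀ l ∈ B, |v1 l| ≤ L := fun l hl ↦ by
    obtain ⟨h1, h2⟩ := hlogk l (hB hl)
    simpa [hv1, hu0, abs_of_nonneg h1] using h2
  have bu2 : ∀ k ∈ A, |u2 k| ≤ L ^ 2 := fun k hk ↦ by
    obtain ⟨h1, h2⟩ := hlogk k (hA hk)
    have e : |u2 k| = Real.log k * Real.log k := by
      simp [hu2, hu1, hu0, abs_mul, abs_of_nonneg h1]
    rw [e]; nlinarith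
  have bv2 : ∀ l ∈ B, |v2 l| ≤ L ^ 2 := fun l hl ↦ by
    obtain ⟨h1, h2⟩ := hlogk l (hB hl)
    have e : |v2 l| = Real.log l * Real.log l := by
      simp [hv2, hv1, hu0, abs_mul, abs_of_nonneg h1]
    rw [e]; nlinarith
  set F : ℂ → ℂ := tw u0 u0 with hF
  set F₁ : ℂ → ℂ := tw u1 u0 + tw u0 v1 with hF₁
  set F₂ : ℂ → ℂ := (tw u2 u0 + tw u1 v1) + (tw u1 v1 + tw u0 v2) with hF₂
  have hF' : ∀ s, HasDerivAt F (F₁ s) s := fun s ↦ hderiv u0 u0 s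
  have hF₁' : ∀ s, HasDerivAt F₁ (F₂ s) s := fun s ↦ (hderiv u1 u0 s).add (hderiv u0 v1 s)
  have hF₂c : Continuous F₂ :=
    ((hcont u2 u0).add (hcont u1 v1)).add ((hcont u1 v1).add (hcont u0 v2))
  -- the summand is `‖F ρ‖`
  have hFρ : ∀ ρ : ℂ, ‖(∑ k ∈ A, (k : ℂ) ^ (-ρ)) * (∑ l ∈ B, (l : ℂ) ^ (ρ - 1))‖ = ‖F ρ‖ := by
    intro ρ; simp [hF, htw, hu0]
  simp_rw [hFρ]
  -- zeros → strip integrals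
  have hzero := sum_zerosBetween_norm_le_strip_integral hF' hF₁' hF₂c hA00 hA₀ T K
  refine hzero.trans (mul_le_mul_of_nonneg_left ?_ (mul_nonneg hA00 (Real.log_nonneg (by
    have : (0 : ℝ) ≤ ((T + K : ℕ) : ℝ) := Nat.cast_nonneg _; linarith))))
  -- strip integrals → mean values
  have hT0 : -T' ≤ (T : ℝ) := by have : (0 : ℝ) ≤ T := Nat.cast_nonneg T; linarith
  have hTK' : (T : ℝ) ≤ ((T + K : ℕ) : ℝ) := by exact_mod_cast Nat.le_add_right T K
  set B₀ : ℝ := (5 * T' + 18 * X) * ((X : ℝ) / M) ^ (3 / 2 : ℝ) with hB₀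
  have hB₀0 : 0 ≤ B₀ := by positivity
  have hI : ∀ {u v : ℕ → ℝ} {U V : ℝ}, 0 ≤ U → 0 ≤ V → (∀ k ∈ A, |u k| ≤ U) →
      (∀ l ∈ B, |v l| ≤ V) →
      ∫ σ in (0 : ℝ)..1, ∫ t in (T : ℝ)..((T + K : ℕ) : ℝ), ‖tw u v (σ + t * I)‖
        ≤ B₀ * U * V := by
    intro u v U V hU hV hu hv
    have h := strip_integral_norm_twoSided_le hM hMX hA hB hU hV hu hv hT' hT0 hTK' hTK
    simp only [htw]
    calc _ ≤ (5 * T' + 18 * X) * U * V * ((X : ℝ) / M) ^ (3 / 2 : ℝ) := h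
      _ = B₀ * U * V := by simp only [hB₀]; ring
  have hIF : ∫ σ in (0 : ℝ)..1, ∫ t in (T : ℝ)..((T + K : ℕ) : ℝ), ‖F (σ + t * I)‖ ≤ B₀ := by
    have := hI (u := u0) (v := u0) zero_le_one zero_le_one bu0 bv0; simpa using this
  have hIF₁ : ∫ σ in (0 : ℝ)..1, ∫ t in (T : ℝ)..((T + K : ℕ) : ℝ), ‖F₁ (σ + t * I)‖
      ≤ 2 * L * B₀ := by
    have h1 := hI (u := u1) (v := u0) hL0 zero_le_one bu1 bv0
    have h2 := hI (u := u0) (v := v1) zero_le_one hL0 bu0 bv1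
    have hadd := strip_integral_norm_add_le (hcont u1 u0) (hcont u0 v1) hTK'
      (a := (T : ℝ)) (b := ((T + K : ℕ) : ℝ))
    simp only [hF₁, Pi.add_apply]
    linarith
  have hIF₂ : ∫ σ in (0 : ℝ)..1, ∫ t in (T : ℝ)..((T + K : ℕ) : ℝ), ‖F₂ (σ + t * I)‖
      ≤ 4 * L ^ 2 * B₀ := by
    have h1 := hI (u := u2) (v := u0) (sq_nonneg L) zero_le_one bu2 bv0
    have h2 := hI (u := u1) (v := v1) hL0 hL0 bu1 bv1
    have h3 := hI (u := u0) (v := v2) zero_le_one (sq_nonneg L) bu0 bv2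
    have hadd1 := strip_integral_norm_add_le (hcont u2 u0) (hcont u1 v1) hTK'
      (a := (T : ℝ)) (b := ((T + K : ℕ) : ℝ))
    have hadd2 := strip_integral_norm_add_le (hcont u1 v1) (hcont u0 v2) hTK'
      (a := (T : ℝ)) (b := ((T + K : ℕ) : ℝ))
    have hadd := strip_integral_norm_add_le ((hcont u2 u0).add (hcont u1 v1))
      ((hcont u1 v1).add (hcont u0 v2)) hTK' (a := (T : ℝ)) (b := ((T + K : ℕ) : ℝ))
    simp only [hF₂, Pi.add_apply] at hadd ⊢
    linarith
  calc (∫ σ in (0 : ℝ)..1, ∫ t in (T : ℝ)..((T + K : ℕ) : ℝ), ‖F (σ + t * I)‖)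
        + 2 * (∫ σ in (0 : ℝ)..1, ∫ t in (T : ℝ)..((T + K : ℕ) : ℝ), ‖F₁ (σ + t * I)‖)
        + ∫ σ in (0 : ℝ)..1, ∫ t in (T : ℝ)..((T + K : ℕ) : ℝ), ‖F₂ (σ + t * I)‖
      ≤ B₀ + 2 * (2 * L * B₀) + 4 * L ^ 2 * B₀ := by linarith
    _ = (1 + 2 * L) ^ 2 * B₀ := by ring

/-! ## The dyadic block estimate -/

/-- `(∑ 1) = T` unit windows: `N(2T) - N(T) ≤ A₀ T log(2T+2)`. [cite: Titchmarsh1986, Thm. 9.2] -/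
theorem sum_zerosBetween_order_le {T : ℕ} {A₀ : ℝ} (hA00 : 0 ≤ A₀)
    (hA₀ : ∀ a : ℝ, 0 ≤ a → (zetaZeroCount (a + 1) : ℝ) - zetaZeroCount a ≤ A₀ * Real.log (a + 2)) :
    ∑ ρ ∈ SchoenfeldBound.zerosBetween (T : ℝ) ((T + T : ℕ) : ℝ), (riemannZetaZeroOrder ρ : ℝ)
      ≤ A₀ * Real.log ((T + T : ℕ) + 2) * T := by
  have h := sum_zerosBetween_windows_le (φ := fun _ ↦ (1 : ℝ)) (T := T) (W := fun _ ↦ (1 : ℝ))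
    (fun _ ↦ zero_le_one) hA00 hA₀ T (fun _ _ _ _ ↦ le_rfl)
  simp only [mul_one, Finset.sum_const, Nat.card_Ico] at h
  simpa using h

/-- **Lindelöf on average at the zeros for `ζ_M(ρ) ζ_M(1-ρ)` above the length.** There is an
absolute constant `C` such that for all naturals `1 ≤ M ≤ T`,
`∑_{T < Im ρ ≤ 2T} m(ρ) ‖ζ_M(ρ)‖ ‖ζ_M(1-ρ)‖ ≤ C (log(2T+2))³ T (T/M)^{3/2}`
(zeros of `ζ` with multiplicity, any real part; `ζ_M(s) = ∑_{k≤M} k^{-s}`).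
[cite: Titchmarsh1986, Theorem 4.11, eq. (4.11.1); Thm. 9.2] -/
theorem exists_sum_zerosBetween_norm_zetaPartialSum_mul_le :
    ∃ C : ℝ, 0 < C ∧ ∀ M T : ℕ, 1 ≤ M → M ≤ T →
      ∑ ρ ∈ SchoenfeldBound.zerosBetween (T : ℝ) ((T + T : ℕ) : ℝ),
          (riemannZetaZeroOrder ρ : ℝ) *
            (‖∑ k ∈ Finset.Icc 1 M, (k : ℂ) ^ (-ρ)‖ * ‖∑ k ∈ Finset.Icc 1 M, (k : ℂ) ^ (-(1 - ρ))‖)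
        ≤ C * Real.log (2 * T + 2) ^ 3 * T * ((T : ℝ) / M) ^ (3 / 2 : ℝ) := by
  obtain ⟨A₀, hA₀pos, hA₀⟩ := Montgomery.exists_zetaZeroCount_add_one_sub_le
  have hA00 : 0 ≤ A₀ := hA₀pos.le
  refine ⟨21146 * A₀, by positivity, fun M T hM hMT ↦ ?_⟩
  have hT1 : 1 ≤ T := hM.trans hMT
  have hT0 : (0 : ℝ) < T := by exact_mod_cast hT1
  have hM0 : (0 : ℝ) < M := by exact_mod_cast hM
  set X : ℕ := T + T with hXdef
  have hMX : M ≤ X := hMT.trans (Nat.le_add_right T T)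
  have hXR : (X : ℝ) = 2 * T := by rw [hXdef]; push_cast; ring
  have hX0 : (0 : ℝ) < X := by rw [hXR]; positivity
  have hIoc : Finset.Ioc M X ⊆ Finset.Ioc M X := le_rfl
  have hsing : ({X} : Finset ℕ) ⊆ Finset.Ioc M X := by
    intro n hn
    rw [Finset.mem_singleton] at hn
    subst hn
    exact Finset.mem_Ioc.2 ⟨by omega, le_rfl⟩
  -- the three two-sided zero sums
  have hT' : (0 : ℝ) < 2 * T := by positivity
  have hTK : ((T + T : ℕ) : ℝ) ≤ 2 * T := by push_cast; linarith
  have hR := sum_zerosBetween_norm_twoSided_le hM hMX hIoc hIoc hT' hTK hA00 hA₀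
  have hQ := sum_zerosBetween_norm_twoSided_le hM hMX hIoc hsing hT' hTK hA00 hA₀
  have hQ' := sum_zerosBetween_norm_twoSided_le hM hMX hsing hIoc hT' hTK hA00 hA₀
  have hN := sum_zerosBetween_order_le (T := T) hA00 hA₀
  -- pointwise
  have hpt : ∀ ρ ∈ SchoenfeldBound.zerosBetween (T : ℝ) ((T + T : ℕ) : ℝ),
      (riemannZetaZeroOrder ρ : ℝ) *
        (‖∑ k ∈ Finset.Icc 1 M, (k : ℂ) ^ (-ρ)‖ * ‖∑ k ∈ Finset.Icc 1 M, (k : ℂ) ^ (-(1 - ρ))‖)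
      ≤ (riemannZetaZeroOrder ρ : ℝ) *
          ‖(∑ k ∈ Finset.Ioc M X, (k : ℂ) ^ (-ρ)) * (∑ l ∈ Finset.Ioc M X, (l : ℂ) ^ (ρ - 1))‖
        + 8 * ((riemannZetaZeroOrder ρ : ℝ) *
          ‖(∑ k ∈ Finset.Ioc M X, (k : ℂ) ^ (-ρ)) * (∑ l ∈ ({X} : Finset ℕ), (l : ℂ) ^ (ρ - 1))‖)
        + 8 * ((riemannZetaZeroOrder ρ : ℝ) *
          ‖(∑ k ∈ ({X} : Finset ℕ), (k : ℂ) ^ (-ρ)) * (∑ l ∈ Finset.Ioc M X, (l : ℂ) ^ (ρ - 1))‖)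
        + 64 / X * (riemannZetaZeroOrder ρ : ℝ) := by
    intro ρ hρ
    have hT0' : (0 : ℝ) ≤ T := hT0.le
    obtain ⟨-, -, -, h3, h4⟩ := (SchoenfeldBound.mem_zerosBetween hT0').1 hρ
    have hmem : ρ ∈ ZetaZeros.riemannZetaNontrivialZeros :=
      SchoenfeldBound.mem_nontrivialZeros_of_mem_zerosBetween hT0' hρ
    have hm : (0 : ℝ) ≤ riemannZetaZeroOrder ρ :=
      SchoenfeldBound.zeroOrder_nonneg_of_mem_zerosBetween hT0' hρ
    have hγpos : 0 < ρ.im := by linarith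
    have hγX : |ρ.im| ≤ X := by rw [abs_of_pos hγpos]; exact_mod_cast h4
    have hXγ : (X : ℝ) ≤ 2 * |ρ.im| := by rw [abs_of_pos hγpos, hXR]; linarith
    have h := norm_zetaPartialSum_mul_le_twoSided hmem hM hMX hγX hXγ
    have := mul_le_mul_of_nonneg_left h hm
    linarith
  refine (Finset.sum_le_sum hpt).trans ?_
  rw [Finset.sum_add_distrib, Finset.sum_add_distrib, Finset.sum_add_distrib, ← Finset.mul_sum,
    ← Finset.mul_sum, ← Finset.mul_sum]
  -- collect
  set LT : ℝ := Real.log ((T + T : ℕ) + 2) with hLT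
  have hLTeq : LT = Real.log (2 * T + 2) := by rw [hLT]; push_cast; ring_nf
  have hLT1 : 1 ≤ LT := by
    rw [hLTeq]
    have h4 : (4 : ℝ) ≤ 2 * T + 2 := by
      have : (1 : ℝ) ≤ T := by exact_mod_cast hT1
      linarith
    have := Real.log_le_log (by norm_num) h4
    have hlog4 : (1 : ℝ) ≤ Real.log 4 := by
      rw [show (4 : ℝ) = 2 ^ 2 by norm_num, Real.log_pow]
      have := Real.log_two_gt_d9; push_cast; linarith
    linarith
  have hT1' : (1 : ℝ) ≤ T := by exact_mod_cast hT1
  have hLX : Real.log X ≤ LT := by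
    rw [hLTeq, hXR]; exact Real.log_le_log (by positivity) (by linarith)
  have hLX0 : 0 ≤ Real.log X := Real.log_nonneg (by rw [hXR]; linarith)
  set B₀ : ℝ := (5 * (2 * T) + 18 * X) * ((X : ℝ) / M) ^ (3 / 2 : ℝ) with hB₀
  have hB₀eq : B₀ = 46 * T * (2 * ((T : ℝ) / M)) ^ (3 / 2 : ℝ) := by
    rw [hB₀, hXR]; ring_nf
  have hpow : (2 * ((T : ℝ) / M)) ^ (3 / 2 : ℝ) ≤ 3 * ((T : ℝ) / M) ^ (3 / 2 : ℝ) := by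
    rw [Real.mul_rpow (by norm_num) (by positivity)]
    refine mul_le_mul_of_nonneg_right ?_ (by positivity)
    have h : (2 : ℝ) ^ (3 / 2 : ℝ) ≤ 3 := by
      have h1 : (2 : ℝ) ^ (3 / 2 : ℝ) = Real.sqrt 8 := by
        rw [show (8 : ℝ) = 2 ^ (3 : ℝ) by norm_num, Real.sqrt_eq_rpow, ← Real.rpow_mul (by norm_num)]
        norm_num
      rw [h1, Real.sqrt_le_left (by norm_num)]; norm_num
    exact h
  have hTM1 : 1 ≤ ((T : ℝ) / M) ^ (3 / 2 : ℝ) :=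
    Real.one_le_rpow ((one_le_div hM0).2 (by exact_mod_cast hMT)) (by norm_num)
  have hB₀le : B₀ ≤ 138 * T * ((T : ℝ) / M) ^ (3 / 2 : ℝ) := by
    rw [hB₀eq]; nlinarith [hT0]
  have hsq : (1 + 2 * Real.log X) ^ 2 ≤ 9 * LT ^ 2 := by nlinarith
  have hmain : ∀ {S : ℝ}, S ≤ A₀ * LT * ((1 + 2 * Real.log X) ^ 2 * B₀) →
      S ≤ A₀ * LT ^ 3 * (1242 * T * ((T : ℝ) / M) ^ (3 / 2 : ℝ)) := by
    intro S hS
    refine hS.trans ?_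
    have h1 : (1 + 2 * Real.log X) ^ 2 * B₀ ≤ 9 * LT ^ 2 * (138 * T * ((T : ℝ) / M) ^ (3 / 2 : ℝ)) :=
      mul_le_mul hsq hB₀le (by positivity) (by positivity)
    calc A₀ * LT * ((1 + 2 * Real.log X) ^ 2 * B₀)
        ≤ A₀ * LT * (9 * LT ^ 2 * (138 * T * ((T : ℝ) / M) ^ (3 / 2 : ℝ))) :=
          mul_le_mul_of_nonneg_left h1 (by positivity)
      _ = A₀ * LT ^ 3 * (1242 * T * ((T : ℝ) / M) ^ (3 / 2 : ℝ)) := by ring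
  have hR' := hmain hR
  have hQ1 := hmain hQ
  have hQ2 := hmain hQ'
  have hN' : 64 / (X : ℝ) * ∑ ρ ∈ SchoenfeldBound.zerosBetween (T : ℝ) ((T + T : ℕ) : ℝ),
      (riemannZetaZeroOrder ρ : ℝ) ≤ A₀ * LT ^ 3 * (32 * T * ((T : ℝ) / M) ^ (3 / 2 : ℝ)) := by
    calc 64 / (X : ℝ) * ∑ ρ ∈ SchoenfeldBound.zerosBetween (T : ℝ) ((T + T : ℕ) : ℝ),
          (riemannZetaZeroOrder ρ : ℝ)
        ≤ 64 / (X : ℝ) * (A₀ * LT * T) := mul_le_mul_of_nonneg_left hN (by positivity)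
      _ = 32 * (A₀ * LT) := by rw [hXR]; field_simp; ring
      _ ≤ 32 * (A₀ * LT) * (LT ^ 2 * (T * ((T : ℝ) / M) ^ (3 / 2 : ℝ))) := by
          refine le_mul_of_one_le_right (by positivity) ?_
          have : (1 : ℝ) ≤ LT ^ 2 := by nlinarith
          calc (1 : ℝ) = 1 * (1 * 1) := by ring
            _ ≤ LT ^ 2 * (T * ((T : ℝ) / M) ^ (3 / 2 : ℝ)) :=
              mul_le_mul this (mul_le_mul hT1' hTM1 (by norm_num) (by positivity)) (by norm_num)
                (by positivity)
      _ = A₀ * LT ^ 3 * (32 * T * ((T : ℝ) / M) ^ (3 / 2 : ℝ)) := by ring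
  rw [← hLTeq]
  have h0 : 0 ≤ A₀ * LT ^ 3 * (T * ((T : ℝ) / M) ^ (3 / 2 : ℝ)) := by positivity
  linarith

end Literature.NumberTheory.LFunctions
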